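import Summits.NavierStokesRegularity.OSWSelfSimilar.SheetREvenEnergySpace
import HarnessLib

/-!
# SHEET-ℝ frame, EVEN ZERO-MASS class `E⁺₀` — dictionary layer 3a: the linearised weak form, the data pairing and the coupling pairing
# as BILINEAR MAPS on the even energy space `EspE L` against the zero-mass even tests, and the Gårding hypothesis structure

HONEST FRAMING (cell ns-blowup GROUP B / zone Z3, case Z3-SR-SPEC EVEN half; 1-D MODEL certificate frame (viscous gCLM/OSW sheet on the
line); not Euler/NS; «violates: none — MODEL»).  Nothing here asserts that a profile exists; no number of record moves.

Twin of `SheetRSolutionOperator` §§1–2 / `SheetRResolventPair` §1 / `SheetRPerturbedResolventC` §1 on `E⁺₀` (DESIGN-Z3-SR-SPEC-EVEN (D1)):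

* `derE p` (the derivative component as a function), `profile_add/_smul`, `derE_add/_smul`, `profileE_facts`;
* `EformE : EspE L hL →ₗ testSpaceE0 →ₗ ℝ`, `(p, (v,v₁)) ↦ linForm L d V (profile p) (derE p) v v₁`, with the fixed-test bound
  (`abs_linForm_profileE_le`, from the parity-free `abs_linForm_le_any`) and `EformE (jmapE vp) vp = linForm(v; v)`;
* `PdataE : W L →ₗ testSpaceE0 →ₗ ℝ`, `(g, (v,v₁)) ↦ ∫ w g v`, `|PdataE g vp| ≤ 2‖g‖‖jmapE vp‖`;
* `BcplE : EspE L hL →ₗ testSpaceE0 →ₗ ℝ`, `(p, (v,v₁)) ↦ ∫ w·(profile p)·v`, `|BcplE p vp| ≤ 4‖p‖‖jmapE vp‖`, symmetric on embedded tests;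
* `GardingDataKE L hL d V K D₀ D₁ V₀ c m` — coefficients of record + a bounded real `K : EspE L hL →L[ℝ] W L` + the GÅRDING bound
  `c‖v₁‖²_w + m‖v‖²_w ≤ linForm(v; v) + ∫ w K(jmapE v)·v` on every ZERO-MASS even test (the even (S1⁺) sentence of
  `CertificateViscousSheetRSpectrumEven`, `c = c₂`, `m = c₁ + γ`), and `coerciveKE_shift`: for real `s` the shifted perturbed form is
  `κ_c(s)`-coercive on zero-mass tests, `κ_c(s) = min(c, 4(m + s))` (`> 0` for `s > −m`).
Four bundled maps, one hypothesis structure; no named fact.  WHAT THIS IS NOT: not NS.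
-/

noncomputable section

namespace Summit.NavierStokesRegularity.OSWSelfSimilar
namespace SheetREvenForms

open _root_.MeasureTheory _root_.Set _root_.Filter _root_.Real SheetRWeakProfilePV SheetRWeakToStrong SheetREnergyClass SheetRWeightedMeasure
  SheetRLinearisedTests SheetREnergySpace SheetRTestSpace SheetRLinearisedFormBounds SheetREvenTests SheetREvenEnergySpace
open scoped Topology ENNReal

/-! ### §1 Profiles of elements of `EspE L` -/

/-- The derivative component `p₁` of an even energy-space element, as a function (the profile is `profile p = baseConst p + prim (derE p)`).
[folklore] -/
abbrev derE {L : ℝ} {hL : 0 < L} (p : EspE L hL) : ℝ → ℝ := (((p : WithLp 2 (W L × W L)).snd : W L) : ℝ → ℝ)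

/-- Unfolding `derE`. [folklore] -/
theorem derE_def {L : ℝ} {hL : 0 < L} (p : EspE L hL) : derE p = (((p : WithLp 2 (W L × W L)).snd : W L) : ℝ → ℝ) := rfl

/-- `profile p x = baseConst p + prim (derE p) x`. [folklore] -/
theorem profile_eq {L : ℝ} {hL : 0 < L} (p : EspE L hL) (x : ℝ) : profile p x = baseConst p + prim (derE p) x := rfl

/-- `baseConst` is additive. [folklore] -/
theorem baseConst_add {L : ℝ} (hL : 0 < L) (p q : EspE L hL) : baseConst (p + q) = baseConst p + baseConst q := by
  set P : WithLp 2 (W L × W L) := (p : WithLp 2 (W L × W L)) with hP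
  set Q : WithLp 2 (W L × W L) := (q : WithLp 2 (W L × W L)) with hQ
  have hcoe : ((p + q : EspE L hL) : WithLp 2 (W L × W L)) = P + Q := Submodule.coe_add _ _
  simp only [baseConst]
  rw [hcoe, WithLp.add_snd, WithLp.add_fst, prim_add hL]
  have hae : (((P.fst + Q.fst : W L)) : ℝ → ℝ) =ᵐ[volume] fun y => ((P.fst : W L) : ℝ → ℝ) y + ((Q.fst : W L) : ℝ → ℝ) y :=
    ae_volume_of_ae_μw hL (Lp.coeFn_add _ _)
  have hcongr : ∫ s in (0 : ℝ)..1, (2 * (((P.fst + Q.fst : W L)) : ℝ → ℝ) s -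
      (prim ((P.snd : W L) : ℝ → ℝ) s + prim ((Q.snd : W L) : ℝ → ℝ) s)) =
      ∫ s in (0 : ℝ)..1, ((2 * ((P.fst : W L) : ℝ → ℝ) s - prim ((P.snd : W L) : ℝ → ℝ) s)
        + (2 * ((Q.fst : W L) : ℝ → ℝ) s - prim ((Q.snd : W L) : ℝ → ℝ) s)) :=
    intervalIntegral.integral_congr_ae (hae.mono fun y hy _ => by rw [hy]; ring)
  rw [hcongr, intervalIntegral.integral_add]
  · exact ((intervalIntegrable_of_W hL _ 0 1).const_mul 2).sub ((continuous_prim hL _).intervalIntegrable 0 1)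
  · exact ((intervalIntegrable_of_W hL _ 0 1).const_mul 2).sub ((continuous_prim hL _).intervalIntegrable 0 1)

/-- `baseConst` is homogeneous. [folklore] -/
theorem baseConst_smul {L : ℝ} (hL : 0 < L) (c : ℝ) (p : EspE L hL) : baseConst (c • p) = c * baseConst p := by
  set P : WithLp 2 (W L × W L) := (p : WithLp 2 (W L × W L)) with hP
  have hcoe : ((c • p : EspE L hL) : WithLp 2 (W L × W L)) = c • P := Submodule.coe_smul _ _
  simp only [baseConst]
  rw [hcoe, WithLp.smul_snd, WithLp.smul_fst, prim_smul hL]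
  have hae : (((c • P.fst : W L)) : ℝ → ℝ) =ᵐ[volume] fun y => c * ((P.fst : W L) : ℝ → ℝ) y :=
    (ae_volume_of_ae_μw hL (Lp.coeFn_smul c _)).mono fun y hy => by rw [hy, Pi.smul_apply, smul_eq_mul]
  have hcongr : ∫ s in (0 : ℝ)..1, (2 * (((c • P.fst : W L)) : ℝ → ℝ) s - c * prim ((P.snd : W L) : ℝ → ℝ) s) =
      ∫ s in (0 : ℝ)..1, c * (2 * ((P.fst : W L) : ℝ → ℝ) s - prim ((P.snd : W L) : ℝ → ℝ) s) :=
    intervalIntegral.integral_congr_ae (hae.mono fun y hy _ => by rw [hy]; ring)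
  rw [hcongr, intervalIntegral.integral_const_mul]

/-- `derE` is additive up to a Lebesgue-null set, and `profile` is additive. [folklore] -/
theorem derE_add {L : ℝ} (hL : 0 < L) (p q : EspE L hL) :
    (derE (p + q) =ᵐ[volume] fun y => derE p y + derE q y) ∧ profile (p + q) = fun x => profile p x + profile q x := by
  have e : (((p + q : EspE L hL) : WithLp 2 (W L × W L)).snd : W L) =
      ((p : WithLp 2 (W L × W L)).snd : W L) + ((q : WithLp 2 (W L × W L)).snd : W L) := by
    rw [Submodule.coe_add, WithLp.add_snd]
  refine ⟨?_, ?_⟩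
  · rw [derE_def, e]; exact ae_volume_of_ae_μw hL (Lp.coeFn_add _ _)
  · funext x
    simp only [profile_eq, baseConst_add hL]
    rw [derE_def, e, prim_add hL]
    ring

/-- `derE` is homogeneous up to a Lebesgue-null set, and `profile` is homogeneous. [folklore] -/
theorem derE_smul {L : ℝ} (hL : 0 < L) (c : ℝ) (p : EspE L hL) :
    (derE (c • p) =ᵐ[volume] fun y => c * derE p y) ∧ profile (c • p) = fun x => c * profile p x := by
  have e : (((c • p : EspE L hL) : WithLp 2 (W L × W L)).snd : W L) = c • ((p : WithLp 2 (W L × W L)).snd : W L) := by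
    rw [Submodule.coe_smul, WithLp.smul_snd]
  refine ⟨?_, ?_⟩
  · rw [derE_def, e]
    exact (ae_volume_of_ae_μw hL (Lp.coeFn_smul c _)).mono fun y hy => by rw [hy, Pi.smul_apply, smul_eq_mul]
  · funext x
    simp only [profile_eq, baseConst_smul hL]
    rw [derE_def, e, prim_smul hL]
    ring

/-- Measurability and weights of `(profile p, derE p)`, with `√∫w(profile p)² = 2‖p₀‖`, `√∫w(derE p)² = ‖p₁‖`. [folklore] -/
theorem profileE_facts {L : ℝ} (hL : 0 < L) (p : EspE L hL) :
    AEStronglyMeasurable (profile p) volume ∧ AEStronglyMeasurable (derE p) volume ∧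
    Integrable (fun y => (L ^ 2 + y ^ 2) * profile p y ^ 2) ∧ Integrable (fun y => (L ^ 2 + y ^ 2) * derE p y ^ 2) ∧
    Real.sqrt (∫ y, (L ^ 2 + y ^ 2) * profile p y ^ 2) = 2 * ‖(p : WithLp 2 (W L × W L)).fst‖ ∧
    Real.sqrt (∫ y, (L ^ 2 + y ^ 2) * derE p y ^ 2) = ‖(p : WithLp 2 (W L × W L)).snd‖ := by
  obtain ⟨-, -, hm, h0, h1, e0, e1, -⟩ := energyClassE_of_mem hL p
  refine ⟨(continuous_profile hL p).aestronglyMeasurable, hm, h0, h1, ?_, ?_⟩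
  · rw [e0, show (4 : ℝ) * ‖(p : WithLp 2 (W L × W L)).fst‖ ^ 2 = (2 * ‖(p : WithLp 2 (W L × W L)).fst‖) ^ 2 by ring,
      Real.sqrt_sq (by positivity)]
  · rw [derE_def, e1, Real.sqrt_sq (norm_nonneg _)]

/-- `‖profile p‖_w ≤ 2‖p‖` in square-root form: `√∫w(profile p)² ≤ 2‖p‖`, and `√∫w(derE p)² ≤ ‖p‖`. [folklore] -/
theorem sqrt_weights_le {L : ℝ} (hL : 0 < L) (p : EspE L hL) :
    Real.sqrt (∫ y, (L ^ 2 + y ^ 2) * profile p y ^ 2) ≤ 2 * ‖p‖ ∧ Real.sqrt (∫ y, (L ^ 2 + y ^ 2) * derE p y ^ 2) ≤ ‖p‖ := by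
  obtain ⟨-, -, -, -, e0, e1⟩ := profileE_facts hL p
  have hf : ‖(p : WithLp 2 (W L × W L)).fst‖ ≤ ‖p‖ := WithLp.norm_fst_le (x := (p : WithLp 2 (W L × W L)))
  have hs : ‖(p : WithLp 2 (W L × W L)).snd‖ ≤ ‖p‖ := WithLp.norm_snd_le (x := (p : WithLp 2 (W L × W L)))
  rw [e0, e1]
  exact ⟨by linarith, hs⟩

/-! ### §2 The weak form, the data pairing and the coupling pairing as bilinear maps -/

section Assembly

variable {L D₀ D₁ V₀ : ℝ} {d V : ℝ → ℝ}

/-- `linForm` of an even energy-space profile against a parity-free test: integrable, with the fixed-test bound `≤ C(v)·‖p‖`. [folklore] -/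
theorem abs_linForm_profileE_le (hL : 0 < L) (hdm : AEStronglyMeasurable d volume) (hVm : AEStronglyMeasurable V volume)
    (hD₁ : 0 ≤ D₁) (hd : ∀ ξ, |d ξ| ≤ D₀ + D₁ * |ξ|) (hV : ∀ ξ, |V ξ| ≤ V₀) {v v₁ : ℝ → ℝ} (hv : IsCompactTestAny v v₁)
    (p : EspE L hL) :
    Integrable (fun y => (L ^ 2 + y ^ 2) * (derE p y * v₁ y) + 2 * y * (derE p y * v y)
        + (L ^ 2 + y ^ 2) * d y * (derE p y * v y) + (L ^ 2 + y ^ 2) * V y * (profile p y * v y)) ∧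
    |linForm L d V (profile p) (derE p) v v₁| ≤
      ((Real.sqrt (∫ y, (L ^ 2 + y ^ 2) * v₁ y ^ 2) + Real.sqrt (∫ y, (L ^ 2 + y ^ 2) * (2 * y * v y / (L ^ 2 + y ^ 2)) ^ 2)
          + Real.sqrt (∫ y, (L ^ 2 + y ^ 2) * (d y * v y) ^ 2)) + 2 * Real.sqrt (∫ y, (L ^ 2 + y ^ 2) * (V y * v y) ^ 2)) * ‖p‖ := by
  obtain ⟨hum, hu₁m, h0, h1, -, -⟩ := profileE_facts hL p
  obtain ⟨e0, e1⟩ := sqrt_weights_le hL p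
  obtain ⟨hint, hle⟩ := abs_linForm_le_any hL hdm hVm hD₁ hd hV hv hum hu₁m h0 h1
  refine ⟨hint, hle.trans ?_⟩
  have hA : 0 ≤ Real.sqrt (∫ y, (L ^ 2 + y ^ 2) * v₁ y ^ 2) + Real.sqrt (∫ y, (L ^ 2 + y ^ 2) * (2 * y * v y / (L ^ 2 + y ^ 2)) ^ 2)
      + Real.sqrt (∫ y, (L ^ 2 + y ^ 2) * (d y * v y) ^ 2) := by positivity
  have hB : 0 ≤ Real.sqrt (∫ y, (L ^ 2 + y ^ 2) * (V y * v y) ^ 2) := Real.sqrt_nonneg _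
  nlinarith [mul_le_mul_of_nonneg_left e1 hA, mul_le_mul_of_nonneg_left e0 hB]

/-- **The weak form as a bilinear map** `EspE L hL →ₗ testSpaceE0 →ₗ ℝ`: `(p, (v, v₁)) ↦ linForm L d V (profile p) (derE p) v v₁`. [folklore] -/
def EformE (hL : 0 < L) (hdm : AEStronglyMeasurable d volume) (hVm : AEStronglyMeasurable V volume)
    (hD₁ : 0 ≤ D₁) (hd : ∀ ξ, |d ξ| ≤ D₀ + D₁ * |ξ|) (hV : ∀ ξ, |V ξ| ≤ V₀) : EspE L hL →ₗ[ℝ] testSpaceE0 →ₗ[ℝ] ℝ :=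
  LinearMap.mk₂ ℝ (fun (p : EspE L hL) (vp : testSpaceE0) => linForm L d V (profile p) (derE p) vp.1.1 vp.1.2)
    (by
      intro p q vp
      obtain ⟨hae, hprof⟩ := derE_add hL p q
      rw [linForm_congr_ae L d V (Eventually.of_forall fun y => congrFun hprof y) hae]
      exact linForm_add_left L d V (abs_linForm_profileE_le hL hdm hVm hD₁ hd hV vp.2.1.toIsCompactTestAny p).1
        (abs_linForm_profileE_le hL hdm hVm hD₁ hd hV vp.2.1.toIsCompactTestAny q).1)
    (by
      intro c p vp
      obtain ⟨hae, hprof⟩ := derE_smul hL c p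
      rw [linForm_congr_ae L d V (Eventually.of_forall fun y => congrFun hprof y) hae, smul_eq_mul]
      exact linForm_smul_left L d V c)
    (by
      intro p vp vq
      change linForm L d V _ _ (fun y => vp.1.1 y + vq.1.1 y) (fun y => vp.1.2 y + vq.1.2 y) = _
      exact linForm_add_right L d V (abs_linForm_profileE_le hL hdm hVm hD₁ hd hV vp.2.1.toIsCompactTestAny p).1
        (abs_linForm_profileE_le hL hdm hVm hD₁ hd hV vq.2.1.toIsCompactTestAny p).1)
    (by
      intro c p vp
      change linForm L d V _ _ (fun y => c * vp.1.1 y) (fun y => c * vp.1.2 y) = _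
      rw [smul_eq_mul]
      exact linForm_smul_right L d V c)

/-- Unfolding `EformE`. [folklore] -/
theorem EformE_apply (hL : 0 < L) (hdm : AEStronglyMeasurable d volume) (hVm : AEStronglyMeasurable V volume)
    (hD₁ : 0 ≤ D₁) (hd : ∀ ξ, |d ξ| ≤ D₀ + D₁ * |ξ|) (hV : ∀ ξ, |V ξ| ≤ V₀) (p : EspE L hL) (vp : testSpaceE0) :
    EformE hL hdm hVm hD₁ hd hV p vp = linForm L d V (profile p) (derE p) vp.1.1 vp.1.2 := by
  simp only [EformE, LinearMap.mk₂_apply]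

/-- The weighted product of an `L²_w` class with a parity-free test is integrable, with `|∫ w g v| ≤ ‖g‖·√∫wv²`. [folklore] -/
theorem integrable_weight_mul_any (hL : 0 < L) (g : W L) {v v₁ : ℝ → ℝ} (hv : IsCompactTestAny v v₁) :
    Integrable (fun y => (L ^ 2 + y ^ 2) * ((g : ℝ → ℝ) y * v y)) ∧
      |∫ y, (L ^ 2 + y ^ 2) * ((g : ℝ → ℝ) y * v y)| ≤ ‖g‖ * Real.sqrt (∫ y, (L ^ 2 + y ^ 2) * v y ^ 2) := by
  obtain ⟨hc, -, -, -⟩ := basic_of_any hv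
  obtain ⟨hi, hb⟩ := integral_weight_abs_mul_le (L := L) (aestronglyMeasurable_of_W hL g) hc.aestronglyMeasurable
    (weightedSq_of_W hL g) (weighted_of_any (L := L) hv).1
  have hint : Integrable (fun y => (L ^ 2 + y ^ 2) * ((g : ℝ → ℝ) y * v y)) := by
    refine hi.mono' ((by fun_prop : AEStronglyMeasurable (fun y : ℝ => L ^ 2 + y ^ 2) volume).mul
      ((aestronglyMeasurable_of_W hL g).mul hc.aestronglyMeasurable)) (Eventually.of_forall fun y => ?_)
    rw [Real.norm_eq_abs, abs_mul, abs_of_nonneg (by positivity : (0:ℝ) ≤ L ^ 2 + y ^ 2)]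
  refine ⟨hint, ?_⟩
  have h1 : |∫ y, (L ^ 2 + y ^ 2) * ((g : ℝ → ℝ) y * v y)| ≤ ∫ y, (L ^ 2 + y ^ 2) * |(g : ℝ → ℝ) y * v y| := by
    rw [← Real.norm_eq_abs]
    refine (norm_integral_le_integral_norm _).trans (le_of_eq (integral_congr_ae (Eventually.of_forall fun y => ?_)))
    show ‖(L ^ 2 + y ^ 2) * ((g : ℝ → ℝ) y * v y)‖ = (L ^ 2 + y ^ 2) * |(g : ℝ → ℝ) y * v y|
    rw [Real.norm_eq_abs, abs_mul, abs_of_nonneg (by positivity : (0:ℝ) ≤ L ^ 2 + y ^ 2)]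
  rw [← norm_W] at hb
  exact h1.trans hb

/-- **The data pairing** `(g, (v, v₁)) ↦ ∫ (L²+ξ²) g v` as a bilinear map `W L →ₗ testSpaceE0 →ₗ ℝ`. [folklore] -/
def PdataE (hL : 0 < L) : W L →ₗ[ℝ] testSpaceE0 →ₗ[ℝ] ℝ :=
  LinearMap.mk₂ ℝ (fun (g : W L) (vp : testSpaceE0) => ∫ y, (L ^ 2 + y ^ 2) * ((g : ℝ → ℝ) y * vp.1.1 y))
    (by
      intro g g' vp
      have hae : ((g + g' : W L) : ℝ → ℝ) =ᵐ[volume] (fun y => (g : ℝ → ℝ) y + (g' : ℝ → ℝ) y) :=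
        ae_volume_of_ae_μw hL (Lp.coeFn_add g g')
      rw [← integral_add (integrable_weight_mul_any hL g vp.2.1.toIsCompactTestAny).1
        (integrable_weight_mul_any hL g' vp.2.1.toIsCompactTestAny).1]
      refine integral_congr_ae (hae.mono fun y hy => ?_)
      simp only [hy]; ring)
    (by
      intro c g vp
      have hae : ((c • g : W L) : ℝ → ℝ) =ᵐ[volume] (fun y => c * (g : ℝ → ℝ) y) :=
        (ae_volume_of_ae_μw hL (Lp.coeFn_smul c g)).mono fun y hy => by rw [hy, Pi.smul_apply, smul_eq_mul]
      rw [smul_eq_mul, ← integral_const_mul]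
      refine integral_congr_ae (hae.mono fun y hy => ?_)
      simp only [hy]; ring)
    (by
      intro g vp vq
      change ∫ y, (L ^ 2 + y ^ 2) * ((g : ℝ → ℝ) y * (vp.1.1 y + vq.1.1 y)) = _
      rw [← integral_add (integrable_weight_mul_any hL g vp.2.1.toIsCompactTestAny).1
        (integrable_weight_mul_any hL g vq.2.1.toIsCompactTestAny).1]
      refine integral_congr_ae (Eventually.of_forall fun y => ?_)
      ring)
    (by
      intro c g vp
      change ∫ y, (L ^ 2 + y ^ 2) * ((g : ℝ → ℝ) y * (c * vp.1.1 y)) = _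
      rw [smul_eq_mul, ← integral_const_mul]
      refine integral_congr_ae (Eventually.of_forall fun y => ?_)
      ring)

/-- Unfolding `PdataE`. [folklore] -/
theorem PdataE_apply (hL : 0 < L) (g : W L) (vp : testSpaceE0) :
    PdataE hL g vp = ∫ y, (L ^ 2 + y ^ 2) * ((g : ℝ → ℝ) y * vp.1.1 y) := by
  simp only [PdataE, LinearMap.mk₂_apply]

/-- `√∫wv² ≤ 2‖jmapE (v, v₁)‖`. [folklore] -/
theorem sqrt_weight_test_le (hL : 0 < L) (vp : testSpaceE0) : Real.sqrt (∫ y, (L ^ 2 + y ^ 2) * vp.1.1 y ^ 2) ≤ 2 * ‖jmapE hL vp‖ := by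
  have hsq := sq_norm_jmapE hL vp
  have hnn : 0 ≤ ∫ y, (L ^ 2 + y ^ 2) * vp.1.2 y ^ 2 := integral_nonneg fun y => by positivity
  have : ∫ y, (L ^ 2 + y ^ 2) * vp.1.1 y ^ 2 ≤ (2 * ‖jmapE hL vp‖) ^ 2 := by nlinarith
  calc Real.sqrt (∫ y, (L ^ 2 + y ^ 2) * vp.1.1 y ^ 2) ≤ Real.sqrt ((2 * ‖jmapE hL vp‖) ^ 2) := Real.sqrt_le_sqrt this
    _ = 2 * ‖jmapE hL vp‖ := Real.sqrt_sq (by positivity)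

/-- The data bound: `|∫ w g v| ≤ 2‖g‖·‖jmapE (v, v₁)‖`. [folklore] -/
theorem abs_PdataE_le (hL : 0 < L) (g : W L) (vp : testSpaceE0) : |PdataE hL g vp| ≤ 2 * ‖g‖ * ‖jmapE hL vp‖ := by
  rw [PdataE_apply]
  calc |∫ y, (L ^ 2 + y ^ 2) * ((g : ℝ → ℝ) y * vp.1.1 y)| ≤ ‖g‖ * Real.sqrt (∫ y, (L ^ 2 + y ^ 2) * vp.1.1 y ^ 2) :=
        (integrable_weight_mul_any hL g vp.2.1.toIsCompactTestAny).2
    _ ≤ ‖g‖ * (2 * ‖jmapE hL vp‖) := mul_le_mul_of_nonneg_left (sqrt_weight_test_le hL vp) (norm_nonneg _)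
    _ = 2 * ‖g‖ * ‖jmapE hL vp‖ := by ring

/-- The weighted product of an even energy-space profile with a zero-mass test is integrable, `|∫ w·profile p·v| ≤ 4‖p‖·‖jmapE (v,v₁)‖`. [folklore] -/
theorem integrable_profileE_mul_test (hL : 0 < L) (p : EspE L hL) (vp : testSpaceE0) :
    Integrable (fun y => (L ^ 2 + y ^ 2) * (profile p y * vp.1.1 y)) ∧
      |∫ y, (L ^ 2 + y ^ 2) * (profile p y * vp.1.1 y)| ≤ 4 * ‖p‖ * ‖jmapE hL vp‖ := by
  obtain ⟨hum, -, h0, -, -, -⟩ := profileE_facts hL p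
  obtain ⟨e0, -⟩ := sqrt_weights_le hL p
  obtain ⟨hc, -, -, -⟩ := basic_of_any vp.2.1.toIsCompactTestAny
  have hwv := (weighted_of_any (L := L) vp.2.1.toIsCompactTestAny).1
  obtain ⟨hi, hb⟩ := integral_weight_abs_mul_le (L := L) hum hc.aestronglyMeasurable h0 hwv
  have hint : Integrable (fun y => (L ^ 2 + y ^ 2) * (profile p y * vp.1.1 y)) := by
    refine hi.mono' ((by fun_prop : AEStronglyMeasurable (fun y : ℝ => L ^ 2 + y ^ 2) volume).mul
      (hum.mul hc.aestronglyMeasurable)) (Eventually.of_forall fun y => ?_)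
    rw [Real.norm_eq_abs, abs_mul, abs_of_nonneg (by positivity : (0:ℝ) ≤ L ^ 2 + y ^ 2)]
  refine ⟨hint, ?_⟩
  have h1 : |∫ y, (L ^ 2 + y ^ 2) * (profile p y * vp.1.1 y)| ≤ ∫ y, (L ^ 2 + y ^ 2) * |profile p y * vp.1.1 y| := by
    rw [← Real.norm_eq_abs]
    refine (norm_integral_le_integral_norm _).trans (le_of_eq (integral_congr_ae (Eventually.of_forall fun y => ?_)))
    show ‖(L ^ 2 + y ^ 2) * (profile p y * vp.1.1 y)‖ = (L ^ 2 + y ^ 2) * |profile p y * vp.1.1 y|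
    rw [Real.norm_eq_abs, abs_mul, abs_of_nonneg (by positivity : (0:ℝ) ≤ L ^ 2 + y ^ 2)]
  have hv := sqrt_weight_test_le hL vp
  calc |∫ y, (L ^ 2 + y ^ 2) * (profile p y * vp.1.1 y)|
      ≤ Real.sqrt (∫ y, (L ^ 2 + y ^ 2) * profile p y ^ 2) * Real.sqrt (∫ y, (L ^ 2 + y ^ 2) * vp.1.1 y ^ 2) := h1.trans hb
    _ ≤ (2 * ‖p‖) * (2 * ‖jmapE hL vp‖) := by
        gcongr
    _ = 4 * ‖p‖ * ‖jmapE hL vp‖ := by ring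

/-- **The coupling pairing** `(p, (v, v₁)) ↦ ∫ (L²+ξ²)·(profile p)·v` as a bilinear map. [folklore] -/
def BcplE (hL : 0 < L) : EspE L hL →ₗ[ℝ] testSpaceE0 →ₗ[ℝ] ℝ :=
  LinearMap.mk₂ ℝ (fun (p : EspE L hL) (vp : testSpaceE0) => ∫ y, (L ^ 2 + y ^ 2) * (profile p y * vp.1.1 y))
    (by
      intro p q vp
      rw [← integral_add (integrable_profileE_mul_test hL p vp).1 (integrable_profileE_mul_test hL q vp).1]
      refine integral_congr_ae (Eventually.of_forall fun y => ?_)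
      simp only [congrFun (derE_add hL p q).2 y]; ring)
    (by
      intro c p vp
      rw [smul_eq_mul, ← integral_const_mul]
      refine integral_congr_ae (Eventually.of_forall fun y => ?_)
      simp only [congrFun (derE_smul hL c p).2 y]; ring)
    (by
      intro p vp vq
      change ∫ y, (L ^ 2 + y ^ 2) * (profile p y * (vp.1.1 y + vq.1.1 y)) = _
      rw [← integral_add (integrable_profileE_mul_test hL p vp).1 (integrable_profileE_mul_test hL p vq).1]
      refine integral_congr_ae (Eventually.of_forall fun y => ?_)
      ring)
    (by
      intro c p vp
      change ∫ y, (L ^ 2 + y ^ 2) * (profile p y * (c * vp.1.1 y)) = _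
      rw [smul_eq_mul, ← integral_const_mul]
      refine integral_congr_ae (Eventually.of_forall fun y => ?_)
      ring)

/-- Unfolding `BcplE`. [folklore] -/
theorem BcplE_apply (hL : 0 < L) (p : EspE L hL) (vp : testSpaceE0) :
    BcplE hL p vp = ∫ y, (L ^ 2 + y ^ 2) * (profile p y * vp.1.1 y) := by
  simp only [BcplE, LinearMap.mk₂_apply]

/-- On embedded tests the coupling pairing is symmetric. [folklore] -/
theorem BcplE_jmapE_symm (hL : 0 < L) (vp vq : testSpaceE0) : BcplE hL (jmapE hL vq) vp = BcplE hL (jmapE hL vp) vq := by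
  rw [BcplE_apply, BcplE_apply, (jmapE_snd_ae hL vq).2.2, (jmapE_snd_ae hL vp).2.2]
  exact integral_congr_ae (Eventually.of_forall fun y => by ring)

/-- `EformE` on the diagonal of an embedded test is `linForm(v; v)`. [folklore] -/
theorem EformE_jmapE (hL : 0 < L) (hdm : AEStronglyMeasurable d volume) (hVm : AEStronglyMeasurable V volume)
    (hD₁ : 0 ≤ D₁) (hd : ∀ ξ, |d ξ| ≤ D₀ + D₁ * |ξ|) (hV : ∀ ξ, |V ξ| ≤ V₀) (vp : testSpaceE0) :
    EformE hL hdm hVm hD₁ hd hV (jmapE hL vp) vp = linForm L d V vp.1.1 vp.1.2 vp.1.1 vp.1.2 := by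
  rw [EformE_apply]
  obtain ⟨hae, -, hprof⟩ := jmapE_snd_ae hL vp
  exact linForm_congr_ae L d V (Eventually.of_forall fun y => congrFun hprof y) hae

end Assembly

/-! ### §3 The Gårding hypothesis structure and the shifted coercivity -/

/-- **Coefficient data with a Gårding bound for the PERTURBED form on the even zero-mass class**: drift/potential of record, a bounded
real `K : EspE L hL →L[ℝ] W L`, and `c‖v₁‖²_w + m‖v‖²_w ≤ linForm(v; v) + ∫ w K(jmapE v)·v` on every ZERO-MASS even test (`c > 0`). [folklore] -/
structure GardingDataKE (L : ℝ) (hL : 0 < L) (d V : ℝ → ℝ) (K : EspE L hL →L[ℝ] W L) (D₀ D₁ V₀ c m : ℝ) : Prop where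
  /-- `d` is a.e.-strongly measurable -/
  d_meas : AEStronglyMeasurable d volume
  /-- `V` is a.e.-strongly measurable -/
  V_meas : AEStronglyMeasurable V volume
  /-- `D₀ ≥ 0` -/
  D₀_nonneg : 0 ≤ D₀
  /-- `D₁ ≥ 0` -/
  D₁_nonneg : 0 ≤ D₁
  /-- linear growth of the drift -/
  d_le : ∀ ξ, |d ξ| ≤ D₀ + D₁ * |ξ|
  /-- boundedness of the potential -/
  V_le : ∀ ξ, |V ξ| ≤ V₀
  /-- `c > 0` -/
  c_pos : 0 < c
  /-- the Gårding lower bound for the perturbed form on zero-mass even tests -/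
  garding : ∀ vp : testSpaceE0,
    c * (∫ ξ, (L ^ 2 + ξ ^ 2) * vp.1.2 ξ ^ 2) + m * ∫ ξ, (L ^ 2 + ξ ^ 2) * vp.1.1 ξ ^ 2 ≤
      linForm L d V vp.1.1 vp.1.2 vp.1.1 vp.1.2 + ∫ y, (L ^ 2 + y ^ 2) * (((K (jmapE hL vp) : W L) : ℝ → ℝ) y * vp.1.1 y)

variable {L D₀ D₁ V₀ c m : ℝ} {d V : ℝ → ℝ} {hL : 0 < L} {K : EspE L hL →L[ℝ] W L}

/-- Coefficient facts of the shift `V + s`. [folklore] -/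
theorem shift_hypsE (h : GardingDataKE L hL d V K D₀ D₁ V₀ c m) (s : ℝ) :
    AEStronglyMeasurable (fun ξ => V ξ + s) volume ∧ ∀ ξ, |V ξ + s| ≤ V₀ + |s| :=
  ⟨h.V_meas.add aestronglyMeasurable_const, fun ξ => (abs_add_le _ _).trans (add_le_add (h.V_le ξ) le_rfl)⟩

/-- `κ_c(s) = min(c, 4(m + s)) > 0` for `s > −m`. [folklore] -/
theorem kappaE_pos (h : GardingDataKE L hL d V K D₀ D₁ V₀ c m) {s : ℝ} (hs : -m < s) : 0 < min c (4 * (m + s)) :=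
  lt_min h.c_pos (by linarith)

/-- **Coercivity of the shifted perturbed form on zero-mass even tests**: for every real `s`,
`κ_c(s)‖jmapE v‖² ≤ linForm L d (V + s) v v₁ v v₁ + ∫ w K(jmapE v)·v`, `κ_c(s) = min(c, 4(m + s))`. [folklore] -/
theorem coerciveKE_shift (h : GardingDataKE L hL d V K D₀ D₁ V₀ c m) (s : ℝ) (vp : testSpaceE0) :
    min c (4 * (m + s)) * ‖jmapE hL vp‖ ^ 2 ≤
      linForm L d (fun ξ => V ξ + s) vp.1.1 vp.1.2 vp.1.1 vp.1.2
        + ∫ y, (L ^ 2 + y ^ 2) * (((K (jmapE hL vp) : W L) : ℝ → ℝ) y * vp.1.1 y) := by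
  obtain ⟨hc, -, -, -⟩ := basic_of_any vp.2.1.toIsCompactTestAny
  obtain ⟨hwv, hwv₁⟩ := weighted_of_any (L := L) vp.2.1.toIsCompactTestAny
  obtain ⟨hint, -⟩ := abs_linForm_le_any hL h.d_meas h.V_meas h.D₁_nonneg h.d_le h.V_le vp.2.1.toIsCompactTestAny
    hc.aestronglyMeasurable vp.2.1.memLp.1 hwv hwv₁
  have hshift : linForm L d (fun ξ => V ξ + s) vp.1.1 vp.1.2 vp.1.1 vp.1.2 =
      linForm L d V vp.1.1 vp.1.2 vp.1.1 vp.1.2 + s * ∫ y, (L ^ 2 + y ^ 2) * vp.1.1 y ^ 2 := by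
    have hvv : Integrable (fun y => (L ^ 2 + y ^ 2) * (vp.1.1 y * vp.1.1 y)) :=
      hwv.congr (Eventually.of_forall fun y => by ring)
    unfold linForm
    rw [← integral_const_mul, ← integral_add hint (hwv.const_mul s)]
    refine integral_congr_ae (Eventually.of_forall fun y => ?_)
    ring
  rw [hshift, sq_norm_jmapE]
  have hG := h.garding vp
  have hκc : min c (4 * (m + s)) ≤ c := min_le_left _ _
  have hκ4 : min c (4 * (m + s)) ≤ 4 * (m + s) := min_le_right _ _
  have hn0 : 0 ≤ ∫ ξ, (L ^ 2 + ξ ^ 2) * vp.1.1 ξ ^ 2 := integral_nonneg fun y => by positivity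
  have hn1 : 0 ≤ ∫ ξ, (L ^ 2 + ξ ^ 2) * vp.1.2 ξ ^ 2 := integral_nonneg fun y => by positivity
  nlinarith [mul_le_mul_of_nonneg_right hκc hn1, mul_le_mul_of_nonneg_right hκ4 hn0]

/-- `GardingDataKE` is monotone in `(c, m)` downwards. [folklore] -/
theorem GardingDataKE.mono (h : GardingDataKE L hL d V K D₀ D₁ V₀ c m) {c' m' : ℝ} (hc' : 0 < c') (hcc : c' ≤ c) (hmm : m' ≤ m) :
    GardingDataKE L hL d V K D₀ D₁ V₀ c' m' := by
  refine ⟨h.d_meas, h.V_meas, h.D₀_nonneg, h.D₁_nonneg, h.d_le, h.V_le, hc', fun vp => ?_⟩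
  have hG := h.garding vp
  have hn0 : 0 ≤ ∫ ξ, (L ^ 2 + ξ ^ 2) * vp.1.1 ξ ^ 2 := integral_nonneg fun y => by positivity
  have hn1 : 0 ≤ ∫ ξ, (L ^ 2 + ξ ^ 2) * vp.1.2 ξ ^ 2 := integral_nonneg fun y => by positivity
  nlinarith [mul_le_mul_of_nonneg_right hcc hn1, mul_le_mul_of_nonneg_right hmm hn0]

end SheetREvenForms
end Summit.NavierStokesRegularity.OSWSelfSimilar

end
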